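import Literature.AlgebraicGeometry.Modules.DerivedPushforwardAcyclicResolution
import Literature.AlgebraicGeometry.Modules.CechSheafRelativeAcyclic
import Literature.AlgebraicGeometry.Modules.CechOrderedResolution
import HarnessLib

/-!
# `Rf_*(M[0])` has cohomological amplitude in `[0, #ι − 1]` for a quasi-coherent `M` and a finite cover of the source by
# `#ι` opens with faces affine over the base (ordered Čech complex; Hartshorne III 8.1 / Ex. 8.2, Stacks 01XD, 02KE)

Layer `Literature/AlgebraicGeometry/Modules`. For `f : X ⟶ Y`, a FINITE linearly ordered family `𝓤 = (U_i)_{i ∈ ι}` of opens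
covering `X` whose faces are affine over `Y` (`IsAffineHom ((face U β).ι ≫ f)`), and an affine-localizing (e.g. quasi-coherent)
`M`, the ORDERED sheaf Čech complex `Č•_ord(𝓤, M)` (`Modules/CechOrderedComplex`: `Čⁿ_ord = Cech.obj (faces U n) 0 M`, one factor
per `(n+1)`-subset of `ι`; exact augmented by `M`, `Modules/CechOrderedResolution`) is an `f_*`-ACYCLIC resolution of `M` that
VANISHES in degrees `≥ #ι`; hence, by `Modules/DerivedPushforwardAcyclicResolution`, `Rf_*(M[0]) ≅ Q(f_* Č•_ord)` is
cohomologically `≤ #ι − 1` (and `≥ 0`).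

* `ExactAugmentation.augmentι`, `ExactAugmentation.quasiIso_augmentι` — any exact augmentation `M → K⁰ → K¹ → ⋯`
  (`Algebra/Homology/IteratedExtClass.ExactAugmentation`) read as a quasi-isomorphism `M[0] ⟶ K•`;
* `CechOrd.isZero_obj` — `Čⁿ_ord(𝓤, M) = 0` for `#ι ≤ n`; `CechOrd.face_faces_eq_face` — a face of the family of `n`-faces is a face
  of `𝓤`; `CechOrd.isPushforwardAcyclic_obj` — `Čⁿ_ord(𝓤, M)` is `f_*`-acyclic (relative `Modules/CechSheafRelativeAcyclic`);
* **`isLE_derivedPushforwardPlus_single`** — `(Rf_*(M[0])).IsLE (#ι − 1)`; with `isGE_zero` this is the amplitude `[0, #ι − 1]`.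

Everything PROVED; 0 named facts; no instances. Typed for the cell `pub-hodge-ring2` (road (m-a′): the «bounded» input of the
vector-bundle model of the descended transform on Markman's secant quotient); a research route conditional on HC_CM, not a
corollary — nothing in this file refers to it.

## References

* R. Hartshorne, *Algebraic Geometry*, GTM 52 (1977), III Prop. 8.1, Ex. 8.2, Thm. 4.5, Ex. 4.8. [Hartshorne1977]
* The Stacks Project, Tags 01XD, 01FG (alternating Čech complex), 02KE. [StacksProject]
* U. Görtz, T. Wedhorn, *Algebraic Geometry II* (2023), Def. 21.68, Prop. 21.69, Thm. 22.9. [GortzWedhorn2023]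
-/

noncomputable section

-- `TopCat.Presheaf`/`Scheme.Modules` are not reducible (as in Mathlib's `AlgebraicGeometry/Modules/Sheaf.lean`).
set_option backward.isDefEq.respectTransparency false

open CategoryTheory CategoryTheory.Limits AlgebraicGeometry Opposite TopologicalSpace

universe w w' v u

/-! ### Exact augmentations as quasi-isomorphisms -/

namespace Literature.Algebra.Homology.ExactAugmentation

variable {C : Type u} [Category.{v} C] [Abelian C] {K : CochainComplex C ℕ} {M : C} (A : ExactAugmentation K M)

/-- **The augmentation `M[0] ⟶ K•` of an exact augmentation `M → K⁰ → K¹ → ⋯`.** [cite: Hartshorne1977, III §1 p. 204 (resolutions)] -/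
def augmentι : (CochainComplex.single₀ C).obj M ⟶ K :=
  (CochainComplex.fromSingle₀Equiv K M).symm ⟨A.ε, A.ε_d⟩

/-- Degree `0` of `augmentι` is `ε`. [cite: Hartshorne1977, III §1 p. 204] -/
@[simp] theorem augmentι_f_zero : A.augmentι.f 0 = A.ε := by simp [augmentι]

/-- **An exact augmentation is a quasi-isomorphism `M[0] ⥲ K•`.** [cite: Hartshorne1977, III §1 p. 204 (resolutions)] -/
theorem quasiIso_augmentι : QuasiIso A.augmentι :=
  ⟨fun n => by
    cases n with
    | zero =>
      rw [CochainComplex.quasiIsoAt₀_iff, ShortComplex.quasiIso_iff_of_zeros]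
      · refine (ShortComplex.exact_and_mono_f_iff_of_iso ?_).2 ⟨A.exact₀, A.mono_ε⟩
        exact ShortComplex.isoMk (Iso.refl _) (Iso.refl _) (Iso.refl _) (by simp) (by simp)
      all_goals first | rfl | exact HomologicalComplex.shape _ _ _ (by simp)
    | succ n =>
      rw [quasiIsoAt_iff_exactAt]
      · exact A.exactAt_succ n
      · exact CochainComplex.exactAt_succ_single_obj M n⟩

end Literature.Algebra.Homology.ExactAugmentation

namespace Literature.AlgebraicGeometry.Modules

open Literature.Algebra.Homology

/-! ### The ordered Čech sheaves: vanishing in high degrees, faces, relative acyclicity -/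

namespace CechOrd

variable {X Y : Scheme.{u}} {ι : Type u} [LinearOrder ι] [Fintype ι] (U : ι → X.Opens) (M : X.Modules)

/-- There is no `(n+1)`-subset of `ι` when `#ι ≤ n`. [cite: GortzWedhorn2023, Def. 21.68] -/
theorem isEmpty_simplex {n : ℕ} (h : Fintype.card ι ≤ n) : IsEmpty (Simplex ι n) :=
  ⟨fun s => by have h' := Finset.card_le_univ s.1; rw [s.2] at h'; lia⟩

/-- **`Čⁿ_ord(𝓤, M) = 0` for `#ι ≤ n`** (no strictly increasing `(n+1)`-tuples). [cite: GortzWedhorn2023, Def. 21.68]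
[cite: StacksProject, Tag 01FG] -/
theorem isZero_obj {n : ℕ} (h : Fintype.card ι ≤ n) : IsZero (obj U M n) := by
  haveI := isEmpty_simplex (ι := ι) h
  haveI : IsEmpty (Idx ι n) := ⟨fun β => isEmptyElim (β 0)⟩
  rw [IsZero.iff_id_eq_zero]
  exact Cech.hom_ext_to fun V s β => isEmptyElim β

omit [Fintype ι] in
/-- A face of the family of `n`-faces of `𝓤` is a face of `𝓤`: `⋂_k U_{s_k} = U_α` for an enumeration `α` of `⋃_k s_k`.
[cite: GortzWedhorn2023, Def. 21.68] -/
theorem face_faces_eq_face {n m : ℕ} (β : Fin (m + 1) → Simplex ι n) :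
    ∃ (k : ℕ) (α : Fin (k + 1) → ι), face (faces U n) β = face U α := by
  classical
  let S : Finset ι := Finset.univ.biUnion fun j => (β j).1
  have hS : S.Nonempty := by
    obtain ⟨i, hi⟩ : ((β 0).1).Nonempty := by
      rw [← Finset.card_pos, (β 0).2]; exact Nat.succ_pos n
    exact ⟨i, Finset.mem_biUnion.mpr ⟨0, Finset.mem_univ _, hi⟩⟩
  obtain ⟨k, hk⟩ : ∃ k, S.card = k + 1 := ⟨S.card - 1, (Nat.sub_add_cancel (Finset.card_pos.mpr hS)).symm⟩
  let e : Fin (k + 1) ≃ S := (hk ▸ S.equivFin).symm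
  refine ⟨k, fun j => (e j).1, le_antisymm ?_ ?_⟩
  · refine le_iInf fun j => ?_
    obtain ⟨j', -, hj'⟩ := Finset.mem_biUnion.mp (e j).2
    exact (face_le (faces U n) β j').trans (faceSet_le hj')
  · refine le_iInf fun j' => ?_
    change face U _ ≤ faceSet U (β j').1
    refine le_iInf₂ fun i hi => ?_
    have hiS : i ∈ S := Finset.mem_biUnion.mpr ⟨j', Finset.mem_univ _, hi⟩
    have hj : (e (e.symm ⟨i, hiS⟩)).1 = i := by rw [Equiv.apply_symm_apply]
    exact (face_le U _ (e.symm ⟨i, hiS⟩)).trans (le_of_eq (congrArg U hj))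

variable (f : X ⟶ Y) (hUaff : ∀ {m : ℕ} (α : Fin (m + 1) → ι), IsAffineHom ((face U α).ι ≫ f))
include hUaff

omit [Fintype ι] in
/-- The faces of the family of `n`-faces are affine over `Y`. [cite: Hartshorne1977, III Prop. 8.7 (proof)] -/
theorem isAffineHom_face_faces_ι_comp {n m : ℕ} (β : Fin (m + 1) → Simplex ι n) :
    IsAffineHom ((face (faces U n) β).ι ≫ f) := by
  obtain ⟨k, α, h⟩ := face_faces_eq_face U β
  haveI := hUaff α
  rw [← X.isoOfEq_hom_ι h, Category.assoc]
  infer_instance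

omit [Fintype ι] in
/-- **`Čⁿ_ord(𝓤, M)` is `f_*`-acyclic** for `M` affine-localizing and a finite cover `𝓤` with faces affine over `Y` (the
relative acyclicity of `Modules/CechSheafRelativeAcyclic` for the family of `n`-faces, with the basis of opens meeting every
face affinely built from `𝓤` itself). [cite: Hartshorne1977, III Prop. 8.7 (proof)] [cite: StacksProject, Tags 02KE and 01XD] -/
theorem isPushforwardAcyclic_obj (hcov : ⨆ i, U i = ⊤) {M : X.Modules} (hM : IsAffineLocalizing M) (n : ℕ) :
    IsPushforwardAcyclic f (obj U M n) := fun V hV => by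
  -- a basis of `X` meeting every face of the family of `n`-faces in an affine open
  have hB : Opens.IsBasis {W : X.Opens | ∀ (m : ℕ) (β : Fin (m + 1) → Simplex ι n), IsAffineOpen (W ⊓ face (faces U n) β)} := by
    rw [Opens.isBasis_iff_nbhd]
    intro O x hx
    obtain ⟨W, hW, hxW, hWO⟩ := Opens.isBasis_iff_nbhd.mp (isBasis_inf_face_affine_rel U f hUaff hcov) hx
    refine ⟨W, fun m β => ?_, hxW, hWO⟩
    obtain ⟨k, α, h⟩ := face_faces_eq_face U β
    rw [h]; exact hW k α
  refine Cech.isAcyclicOn_obj_of_isAffineLocalizing (faces U n) 0 hB (fun m β => ?_) hM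
  haveI := isAffineHom_face_faces_ι_comp U f hUaff β
  exact isAffineOpen_preimage_inf_of_isAffineHom f (face (faces U n) β) hV

end CechOrd

/-! ### The amplitude bound -/

section Amplitude

variable {X Y : Scheme.{u}} (f : X ⟶ Y) [HasDerivedCategory.{w} X.Modules] [HasDerivedCategory.{w'} Y.Modules]
  {ι : Type u} [LinearOrder ι] [Fintype ι] (U : ι → X.Opens) (hcov : ⨆ i, U i = ⊤)
  (hUaff : ∀ {m : ℕ} (α : Fin (m + 1) → ι), IsAffineHom ((face U α).ι ≫ f))
include hcov hUaff

/-- **`Rf_*(M[0]) ≅ Q(f_* Č•_ord(𝓤, M))`** for `M` affine-localizing and a finite cover with faces affine over `Y`.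
[cite: Hartshorne1977, III Prop. 8.7 (proof)] [cite: StacksProject, Tag 02KE] -/
theorem nonempty_derivedPushforwardPlus_single_iso_cechOrd {M : X.Modules} (hM : IsAffineLocalizing M) :
    Nonempty ((derivedPushforwardPlus f).obj ((DerivedCategory.Plus.singleFunctor X.Modules 0).obj M) ≅
      DerivedCategory.Plus.Q.obj ((Scheme.Modules.pushforward f).mapCochainComplexPlus.obj (plusOfNat (CechOrd.complex U M)))) :=
  haveI := (CechOrd.exactAugmentation U M hcov).quasiIso_augmentι
  nonempty_derivedPushforwardPlus_single_iso_of_isPushforwardAcyclic f M (CechOrd.complex U M)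
    (CechOrd.exactAugmentation U M hcov).augmentι (fun n => CechOrd.isPushforwardAcyclic_obj U f hUaff hcov hM n)

/-- **`Rf_*(M[0])` is cohomologically `≤ #ι − 1`** for `M` affine-localizing (e.g. quasi-coherent) and a finite cover of `X` by
`#ι` opens with faces affine over `Y`: the ordered Čech model vanishes in degrees `≥ #ι`.
[cite: Hartshorne1977, III Ex. 8.2 and Ex. 4.8] [cite: StacksProject, Tags 01XD and 02KE] -/
theorem isLE_derivedPushforwardPlus_single {M : X.Modules} (hM : IsAffineLocalizing M) :
    ((derivedPushforwardPlus f).obj ((DerivedCategory.Plus.singleFunctor X.Modules 0).obj M)).IsLE ((Fintype.card ι : ℤ) - 1) := by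
  obtain ⟨e⟩ := nonempty_derivedPushforwardPlus_single_iso_cechOrd f U hcov hUaff hM
  let K := (Scheme.Modules.pushforward f).mapCochainComplexPlus.obj (plusOfNat (CechOrd.complex U M))
  -- the model is STRICTLY `≤ #ι − 1`
  have hK : CochainComplex.IsStrictlyLE K.obj ((Fintype.card ι : ℤ) - 1) := by
    rw [CochainComplex.isStrictlyLE_iff]
    intro i hi
    change IsZero ((Scheme.Modules.pushforward f).obj ((plusOfNat (CechOrd.complex U M)).obj.X i))
    refine ((Scheme.Modules.pushforward f).map_isZero ?_)
    by_cases h0 : 0 ≤ i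
    · obtain ⟨k, rfl⟩ := Int.eq_ofNat_of_zero_le h0
      refine IsZero.of_iso ?_ (HomologicalComplex.extendXIso _ ComplexShape.embeddingUpNat (i := k) rfl)
      exact CechOrd.isZero_obj U M (by lia)
    · haveI := isStrictlyGE_plusOfNat (CechOrd.complex U M)
      exact CochainComplex.isZero_of_isStrictlyGE _ 0 i (by lia)
  haveI : (DerivedCategory.Plus.Q.obj K).IsLE ((Fintype.card ι : ℤ) - 1) := by
    rw [← DerivedCategory.Plus.isLE_ι_obj_iff]
    haveI := hK
    haveI : CochainComplex.IsLE K.obj ((Fintype.card ι : ℤ) - 1) := inferInstance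
    exact DerivedCategory.TStructure.t.isLE_of_iso (ιQObjIso K).symm _
  exact DerivedCategory.Plus.TStructure.t.isLE_of_iso e.symm _

end Amplitude

end Literature.AlgebraicGeometry.Modules

end
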